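import Literature.Barriers.QuantumAdvantage.PPolyOraclesLem75Circuit
import Literature.Computability.QuantumComplexity.PeriodFindingFactor
import Literature.Computability.QuantumComplexity.PeriodFindingDecode
import Literature.Computability.QuantumComplexity.CoinFamilyKernel
import Literature.Computability.QuantumComplexity.RevArith
import HarnessLib

/-!
# Aaronson–Chen 2017, Lemma 7.5 (2)–(3): the period-finding oracle family, II — Kitaev's frame and the read-out law

Topic `Literature/Barriers/QuantumAdvantage`; second file of the discharge of
`aaronsonChen2017_lem75_quantum` (sequel of `PPolyOraclesLem75Circuit.lean`, whose classical
block `V` maps `|x y 0…0⟩ ↦ |x y (Rw y)⟩` relative to the oracle). Kitaev's frame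
`kitaevCircuit V σ` (Hadamard on the coins, `V`, `S³` on the sine-test controls, Hadamard on the
coins; Kitaev 1995, §3) is put around `V`, and the Born law of the measured controls is computed
EXACTLY, block by block:

* the frame relative to an oracle (`kitaevCircuit_runOn_rel`, `_tri_rel`, `_prob_coins_rel`:
  the tree's lemmas verbatim, the Hadamard and phase layers being oracle-free);
* the coin layout as equivalences (`Slot`, `coinIx`, `coinSigma`, active/idle split `actIdle`
  of a block probing length `b`), the sine pattern `sig`, **the circuit `circ` and the family**;
* the one-coin factors `phi` (`sPhase_mul_ySign`), the block value from the active coins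
  (`zAct`, `zOf_ofFn`), the fibre map `gS`, the fibre condition split over the blocks
  (`Rw_eq_iff`, `fibEquiv`) and **`fiber_norm_sq_Rw`**: the fibre norm-sum of a read-out is the
  product over the blocks of an idle factor and an active fibre norm-sum
  (`PeriodFindingFactor.fiber_norm_sq_blocks/_idle`);
* summing out the idle read-outs (`sum_prod_idle`) and the offset read-outs
  (`sum_AactS`, by `sum_fiber_norm_sq_active_signChar`, i.e. `readout_identity`), the block factor
  for a prescribed hit value (`block_factor`) and **`prob_hitPattern(_out)`**: for hit predicates
  `h s` on the active controls and an event `acc` on the pattern of hits, the Born probability of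
  an accepted pattern is that of `acc` under INDEPENDENT hits, block `s` hitting with probability
  `pT s = ∑_u Wt s u · P_u[h s]` — `Wt s u = S_G(u)/4^b` the label weights of the block's table
  (`PeriodFindingFourier.fiberSum`) and `P_u` the product law of Kitaev's single tests at label `u`.

## References

* S. Aaronson, L. Chen, CCC 2017, arXiv:1612.05903, Lemma 7.5, App. 13 (p. 42) [AaronsonChen2017].
* A. Yu. Kitaev, arXiv:quant-ph/9511026 (1995), §3 (Remark 8, Lemma 8, Lemma 10), §4 [Kitaev1995].
* P. W. Shor, SIAM J. Comput. 26 (1997), §5 [Shor1997].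
* M. A. Nielsen, I. L. Chuang, CUP 2010, §2.2.5, §2.2.8 [NielsenChuang2010].
-/

noncomputable section

namespace Literature.Barriers.QuantumAdvantage

namespace Lem75Q

open _root_.Computability Literature.Computability.Complexity Literature.Computability.Cryptography
  Literature.Computability.Cryptography.Kitaev1995
  Literature.Computability.QuantumComplexity.PeriodFinding Matrix Finset
open Literature.Computability.QuantumComplexity hiding natBits length_natBits

/-! ### Kitaev's frame relative to an oracle -/

section KitaevRel

variable {n k m : ℕ} (A : Language Bool)

/-- The phase layer is oracle-free. [folklore] -/
theorem phaseLayer_toMatrix (σ : Fin k → Bool) :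
    (⟨phaseLayer n k m σ⟩ : QCircuit cliffordT (n + (k + m))).toMatrix A =
      (⟨phaseLayer n k m σ⟩ : QCircuit cliffordT (n + (k + m))).toMatrix 0 :=
  QCircuit.toMatrix_eq_of_isOracleFree (fun g hg => phaseLayerL_isOracleFree _ _ g hg) A 0

/-- **The output state of Kitaev's circuit relative to an oracle**, for a classical block (which
may contain oracle gates) acting as `|x y 0^m⟩ ↦ |x y (R y)⟩` relative to `A`
(`kitaevCircuit_runOn` verbatim with `A` for the empty oracle: the Hadamard and phase layers are
oracle-free). [cite: Kitaev1995, §3 (Remark 8, Lemma 8)] -/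
theorem kitaevCircuit_runOn_rel (V : QCircuit cliffordT (n + (k + m))) (σ : Fin k → Bool)
    (x : QReg n) (R : QReg k → QReg m)
    (hV : ∀ y : QReg k, V.toMatrix A *ᵥ basisState (coinInput x y) = basisState (tri x y (R y))) :
    (kitaevCircuit V σ).runOn A (basisState (padInput x (k + m))) =
      (invSqrt2 ^ k * invSqrt2 ^ k) •
        ∑ y : QReg k, ∑ y' : QReg k, (sPhase σ y * ySign y y') • basisState (tri x y' (R y)) := by
  have hsplit : kitaevCircuit V σ =
      ((((⟨hadamardLayer n k m⟩ : QCircuit cliffordT _).append V).append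
        ⟨phaseLayer n k m σ⟩).append ⟨hadamardLayer n k m⟩) := by
    simp [kitaevCircuit, QCircuit.append]
  rw [QCircuit.runOn, hsplit, QCircuit.toMatrix_append, QCircuit.toMatrix_append,
    QCircuit.toMatrix_append, ← Matrix.mulVec_mulVec, ← Matrix.mulVec_mulVec,
    ← Matrix.mulVec_mulVec, hadamardLayer_toMatrix, phaseLayer_toMatrix, hadamardLayer_mulVec_padInput,
    Matrix.mulVec_smul, Matrix.mulVec_sum,
    Finset.sum_congr rfl fun y _ => hV y, Matrix.mulVec_smul, Matrix.mulVec_sum,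
    Finset.sum_congr rfl fun y _ => phaseLayer_mulVec_tri σ x y (R y), Matrix.mulVec_smul,
    Matrix.mulVec_sum]
  simp_rw [Matrix.mulVec_smul, hadamardLayer_mulVec_tri, smul_smul, Finset.smul_sum, smul_smul]
  refine Finset.sum_congr rfl fun y _ => Finset.sum_congr rfl fun y' _ => ?_
  congr 1
  ring

/-- **The output amplitudes relative to an oracle**: `ψ(x γ ρ) = 2^{-k} ∑_{y : R y = ρ} (-i)^{#σ∧y} (-1)^{y·γ}`.
[cite: Kitaev1995, §3 (Remark 8, Lemma 8)] -/
theorem kitaevCircuit_runOn_tri_rel (V : QCircuit cliffordT (n + (k + m))) (σ : Fin k → Bool)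
    (x : QReg n) (R : QReg k → QReg m)
    (hV : ∀ y : QReg k, V.toMatrix A *ᵥ basisState (coinInput x y) = basisState (tri x y (R y)))
    (γ : QReg k) (ρ : QReg m) :
    (kitaevCircuit V σ).runOn A (basisState (padInput x (k + m))) (tri x γ ρ) =
      (invSqrt2 ^ k * invSqrt2 ^ k) *
        ∑ y ∈ univ.filter (fun y => R y = ρ), sPhase σ y * ySign y γ := by
  classical
  rw [kitaevCircuit_runOn_rel A V σ x R hV]
  simp only [Pi.smul_apply, Finset.sum_apply, smul_eq_mul, basisState_apply, tri_eq_tri_iff,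
    true_and, mul_ite, mul_one, mul_zero]
  congr 1
  rw [Finset.sum_filter]
  refine Finset.sum_congr rfl fun y _ => ?_
  rw [Finset.sum_eq_single γ]
  · by_cases h : R y = ρ
    · rw [if_pos ⟨rfl, h.symm⟩, if_pos h]
    · rw [if_neg (fun h' => h h'.2.symm), if_neg h]
  · intro y' _ hy'
    exact if_neg fun h' => hy' h'.1.symm
  · intro h; exact absurd (Finset.mem_univ _) h

/-- Off the labels `x γ ρ` the output amplitude vanishes. [folklore] -/
theorem kitaevCircuit_runOn_of_ne_rel (V : QCircuit cliffordT (n + (k + m))) (σ : Fin k → Bool)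
    (x : QReg n) (R : QReg k → QReg m)
    (hV : ∀ y : QReg k, V.toMatrix A *ᵥ basisState (coinInput x y) = basisState (tri x y (R y)))
    (x' : QReg n) (hx : x' ≠ x) (γ : QReg k) (ρ : QReg m) :
    (kitaevCircuit V σ).runOn A (basisState (padInput x (k + m))) (tri x' γ ρ) = 0 := by
  classical
  rw [kitaevCircuit_runOn_rel A V σ x R hV]
  simp only [Pi.smul_apply, Finset.sum_apply, smul_eq_mul, basisState_apply, tri_eq_tri_iff]
  rw [Finset.sum_eq_zero fun y _ => Finset.sum_eq_zero fun y' _ => by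
    rw [if_neg (fun h => hx h.1), mul_zero], mul_zero]

/-- **Probability of a coin event, relative to an oracle**: `∑_{γ ∈ E} ∑_ρ |ψ(x γ ρ)|²`. [folklore] -/
theorem kitaevCircuit_prob_coins_rel (V : QCircuit cliffordT (n + (k + m))) (σ : Fin k → Bool)
    (x : QReg n) (R : QReg k → QReg m)
    (hV : ∀ y : QReg k, V.toMatrix A *ᵥ basisState (coinInput x y) = basisState (tri x y (R y)))
    (E : Finset (QReg k)) :
    ∑ z ∈ univ.filter (fun z : QReg (n + (k + m)) => (fun j => z (coinWire n k m j)) ∈ E),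
        ‖(kitaevCircuit V σ).runOn A (basisState (padInput x (k + m))) z‖ ^ 2 =
      ∑ γ ∈ E, ∑ ρ : QReg m,
        ‖(kitaevCircuit V σ).runOn A (basisState (padInput x (k + m))) (tri x γ ρ)‖ ^ 2 := by
  classical
  set ψ := (kitaevCircuit V σ).runOn A (basisState (padInput x (k + m))) with hψ
  rw [Finset.sum_filter, ← Fintype.sum_equiv (triEquiv n k m)
    (fun p => if (fun j => (triEquiv n k m p) (coinWire n k m j)) ∈ E then
      ‖ψ (triEquiv n k m p)‖ ^ 2 else 0) _ (fun p => rfl)]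
  rw [Fintype.sum_prod_type, Fintype.sum_eq_single x]
  · rw [Fintype.sum_prod_type]
    have h1 : ∀ (γ : QReg k) (ρ : QReg m), (triEquiv n k m) (x, γ, ρ) = tri x γ ρ := fun _ _ => rfl
    simp only [h1, tri_coinWire]
    have h2 : ∀ γ : QReg k, ((fun j => γ j) ∈ E) = (γ ∈ E) := fun γ => rfl
    simp only [h2, Finset.sum_ite_irrel, Finset.sum_const_zero]
    rw [← Finset.sum_filter, Finset.filter_mem_eq_inter, Finset.univ_inter]
  · intro x' hx'
    rw [Fintype.sum_prod_type]
    refine Finset.sum_eq_zero fun γ _ => Finset.sum_eq_zero fun ρ _ => ?_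
    simp only [triEquiv, Equiv.coe_fn_mk]
    rw [hψ, kitaevCircuit_runOn_of_ne_rel A V σ x R hV x' hx' γ ρ, norm_zero]
    simp

end KitaevRel

variable (P : Params)

/-! ### The coin layout as an equivalence -/

section CoinIx

variable (n : ℕ)

/-- The coins of one block: an offset bit `j < bM` or a control `(e, t)`, level `e < bM`,
`t < 2 Bt` (type `Bt ≤ t`, repetition `t mod Bt`). [folklore] -/
abbrev Slot : Type := Fin (P.bM n) ⊕ (Fin (P.bM n) × Fin (2 * P.Bt n))

/-- The slot layout: offsets first, then the controls level by level. [folklore] -/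
def slotFin : Slot P n ≃ Fin (P.wS n) :=
  (Equiv.sumCongr (Equiv.refl _) finProdFinEquiv).trans finSumFinEquiv

/-- **The coin layout**: block `s`, then the slot. [folklore] -/
def coinIx : Fin (P.S n) × Slot P n ≃ Fin (P.K n) :=
  (Equiv.prodCongr (Equiv.refl _) (slotFin P n)).trans finProdFinEquiv

/-- The coins split into the blocks. [folklore] -/
def coinSigma : Fin (P.K n) ≃ Σ _ : Fin (P.S n), Slot P n :=
  (coinIx P n).symm.trans (Equiv.sigmaEquivProd _ _).symm

/-- The wire index of an offset coin. [folklore] -/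
theorem coinIx_inl_val (s : Fin (P.S n)) (j : Fin (P.bM n)) :
    ((coinIx P n) (s, Sum.inl j) : ℕ) = P.cOff n s j := by
  show (j : ℕ) + P.wS n * s = s * P.wS n + j
  ring

/-- The wire index of a control coin. [folklore] -/
theorem coinIx_inr_val (s : Fin (P.S n)) (e : Fin (P.bM n)) (t : Fin (2 * P.Bt n)) :
    ((coinIx P n) (s, Sum.inr (e, t)) : ℕ) = P.cCtl n s e t := by
  show (P.bM n + ((t : ℕ) + 2 * P.Bt n * e)) + P.wS n * s = s * P.wS n + P.bM n + e * (2 * P.Bt n) + t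
  ring

/-- `coinSigma` in terms of `coinIx`. [folklore] -/
@[simp] theorem coinSigma_symm_apply (s : Fin (P.S n)) (u : Slot P n) :
    (coinSigma P n).symm ⟨s, u⟩ = coinIx P n (s, u) := rfl

/-- **The sine-test pattern**: control `(e, t)` is a sine test iff `Bt ≤ t`. [cite: Kitaev1995, §3 Remark 8] -/
def sig : Fin (P.K n) → Bool := fun c =>
  match ((coinIx P n).symm c).2 with
  | Sum.inl _ => false
  | Sum.inr (_, t) => decide (P.Bt n ≤ (t : ℕ))

/-- The pattern on an offset coin. [folklore] -/
@[simp] theorem sig_inl (s : Fin (P.S n)) (j : Fin (P.bM n)) : sig P n (coinIx P n (s, Sum.inl j)) = false := by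
  simp [sig]

/-- The pattern on a control coin. [folklore] -/
@[simp] theorem sig_inr (s : Fin (P.S n)) (e : Fin (P.bM n)) (t : Fin (2 * P.Bt n)) :
    sig P n (coinIx P n (s, Sum.inr (e, t))) = decide (P.Bt n ≤ (t : ℕ)) := by
  simp [sig]

end CoinIx

/-! ### The circuit and the family -/

section Family

/-- **The period-finding circuit at input length `n`**: Kitaev's frame around `V`.
[cite: AaronsonChen2017, App. 13 (p. 42)] [cite: Kitaev1995, §3 (Remark 8, Lemma 8, Lemma 10)] -/
def circ (n : ℕ) : QCircuit cliffordT (n + (P.K n + mW P n)) := kitaevCircuit (V P n) (sig P n)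

/-- **The period-finding family.** [cite: AaronsonChen2017, Lemma 7.5 (2)–(3)] -/
def family : QCircuitFamily cliffordT := ⟨fun n => P.K n + mW P n, fun n => circ P n⟩

end Family

/-! ### Active and idle coins of a block -/

section ActIdle

variable (n : ℕ)

/-- The active coins of a block probing length `b`: offsets `t < b` and controls of levels `< b`. [folklore] -/
abbrev Act (b : ℕ) : Type := Fin b ⊕ (Fin b × Fin (2 * P.Bt n))

/-- The idle coins of a block probing length `b`. [folklore] -/
abbrev Idle (b : ℕ) : Type := Fin (P.bM n - b) ⊕ (Fin (P.bM n - b) × Fin (2 * P.Bt n))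

/-- `Fin bM` as `Fin b ⊕ Fin (bM - b)`. [folklore] -/
def splitFin {b bM : ℕ} (hb : b ≤ bM) : Fin bM ≃ Fin b ⊕ Fin (bM - b) :=
  (finCongr (by omega)).trans finSumFinEquiv.symm

/-- The value of an active index. [folklore] -/
@[simp] theorem splitFin_symm_inl {b bM : ℕ} (hb : b ≤ bM) (t : Fin b) :
    ((splitFin hb).symm (Sum.inl t) : ℕ) = t := by
  simp [splitFin]

/-- The value of an idle index. [folklore] -/
@[simp] theorem splitFin_symm_inr {b bM : ℕ} (hb : b ≤ bM) (j : Fin (bM - b)) :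
    ((splitFin hb).symm (Sum.inr j) : ℕ) = b + j := by
  simp [splitFin]

variable {n}

/-- **The active/idle split of the coins of a block.** [folklore] -/
def actIdle {b : ℕ} (hb : b ≤ P.bM n) : Slot P n ≃ Act P n b ⊕ Idle P n b :=
  (Equiv.sumCongr (splitFin hb)
    ((Equiv.prodCongr (splitFin hb) (Equiv.refl _)).trans (Equiv.sumProdDistrib _ _ _))).trans
    (Equiv.sumSumSumComm _ _ _ _)

/-- An active offset is the offset of the same index. [folklore] -/
theorem actIdle_symm_inl_inl {b : ℕ} (hb : b ≤ P.bM n) (t : Fin b) :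
    (actIdle P hb).symm (Sum.inl (Sum.inl t)) = Sum.inl ((splitFin hb).symm (Sum.inl t)) := rfl

/-- An active control is the control of the same level and index. [folklore] -/
theorem actIdle_symm_inl_inr {b : ℕ} (hb : b ≤ P.bM n) (j : Fin b × Fin (2 * P.Bt n)) :
    (actIdle P hb).symm (Sum.inl (Sum.inr j)) = Sum.inr ((splitFin hb).symm (Sum.inl j.1), j.2) := rfl

/-- An idle offset. [folklore] -/
theorem actIdle_symm_inr_inl {b : ℕ} (hb : b ≤ P.bM n) (j : Fin (P.bM n - b)) :
    (actIdle P hb).symm (Sum.inr (Sum.inl j)) = Sum.inl ((splitFin hb).symm (Sum.inr j)) := rfl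

/-- An idle control. [folklore] -/
theorem actIdle_symm_inr_inr {b : ℕ} (hb : b ≤ P.bM n) (j : Fin (P.bM n - b) × Fin (2 * P.Bt n)) :
    (actIdle P hb).symm (Sum.inr (Sum.inr j)) = Sum.inr ((splitFin hb).symm (Sum.inr j.1), j.2) := rfl

/-- The split of an active offset. [folklore] -/
@[simp] theorem actIdle_inl_active {b : ℕ} (hb : b ≤ P.bM n) (t : Fin b) :
    actIdle P hb (Sum.inl ((splitFin hb).symm (Sum.inl t))) = Sum.inl (Sum.inl t) := by
  rw [← actIdle_symm_inl_inl]; exact Equiv.apply_symm_apply _ _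

/-- The split of an active control. [folklore] -/
@[simp] theorem actIdle_inr_active {b : ℕ} (hb : b ≤ P.bM n) (j : Fin b × Fin (2 * P.Bt n)) :
    actIdle P hb (Sum.inr ((splitFin hb).symm (Sum.inl j.1), j.2)) = Sum.inl (Sum.inr j) := by
  rw [← actIdle_symm_inl_inr]; exact Equiv.apply_symm_apply _ _

/-- The split of an idle offset. [folklore] -/
@[simp] theorem actIdle_inl_idle {b : ℕ} (hb : b ≤ P.bM n) (j : Fin (P.bM n - b)) :
    actIdle P hb (Sum.inl ((splitFin hb).symm (Sum.inr j))) = Sum.inr (Sum.inl j) := by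
  rw [← actIdle_symm_inr_inl]; exact Equiv.apply_symm_apply _ _

/-- The split of an idle control. [folklore] -/
@[simp] theorem actIdle_inr_idle {b : ℕ} (hb : b ≤ P.bM n) (j : Fin (P.bM n - b) × Fin (2 * P.Bt n)) :
    actIdle P hb (Sum.inr ((splitFin hb).symm (Sum.inr j.1), j.2)) = Sum.inr (Sum.inr j) := by
  rw [← actIdle_symm_inr_inr]; exact Equiv.apply_symm_apply _ _

end ActIdle

/-! ### One-coin factors, block values and the fibre map -/

section Fibre

variable {n : ℕ} (A : Language Bool)

/-- **The one-coin factor** of Kitaev's amplitude for read-out `γ`: `1` on `|0⟩`,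
`(-1)^{γ_c} (-i)^{σ_c}` on `|1⟩` (`sPhase_mul_ySign`). [cite: Kitaev1995, §3 Remark 8] -/
def phi (γ : QReg (P.K n)) (c : Fin (P.K n)) (v : Bool) : ℂ :=
  if v then (if γ c then (-1 : ℂ) else 1) * (if sig P n c then -Complex.I else 1) else 1

/-- The amplitude of a coin assignment is the product of the one-coin factors. [cite: Kitaev1995, §3 Remark 8] -/
theorem sPhase_mul_ySign_eq (y γ : QReg (P.K n)) : sPhase (sig P n) y * ySign y γ = ∏ c, phi P γ c (y c) :=
  sPhase_mul_ySign _ _ _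

/-- **The value of a block from its active coins**: offset plus selected exponent, modulo `2^b`. [cite: Kitaev1995, §3 (Lemma 10)] -/
def zAct (b : ℕ) (ya : Act P n b → Bool) : ℕ :=
  (Nat.ofBits (fun t => ya (Sum.inl t)) +
    expo (fun j : Fin b × Fin (2 * P.Bt n) => (j.1 : ℕ)) (fun j => ya (Sum.inr j))) % 2 ^ b

/-- **The bits written for block `s` holding value `z`**: `[hdr n i (z in b digits) ∈ A]`, `i < b`.
[cite: AaronsonChen2017, Thm. 7.6 (proof, p. 30)] -/
def Gfun (n s : ℕ) (z : ℕ) : Fin (P.bOf n s) → Bool :=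
  fun i => A.boolIndicator (hdr n i (natBits (P.bOf n s) z))

/-- The fibre map of block `s` on the coins of the block. [folklore] -/
def gS (s : Fin (P.S n)) (ys : Slot P n → Bool) : Fin (P.bOf n s) → Bool :=
  Gfun P A n s (zAct P (P.bOf n s) fun a => ys ((actIdle P (P.bOf_le n s.isLt)).symm (Sum.inl a)))

/-- Reading an offset coin off the coin string. [folklore] -/
theorem getD_ofFn_cOff (y : QReg (P.K n)) (s : Fin (P.S n)) (j : Fin (P.bM n)) :
    (List.ofFn y).getD (P.cOff n s j) false = y (coinIx P n (s, Sum.inl j)) := by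
  rw [OCoin.getD_ofFn, dif_pos (by rw [← coinIx_inl_val]; exact Fin.isLt _)]
  congr 1
  exact Fin.ext (coinIx_inl_val P n s j).symm

/-- Reading a control coin off the coin string. [folklore] -/
theorem getD_ofFn_cCtl (y : QReg (P.K n)) (s : Fin (P.S n)) (e : Fin (P.bM n)) (t : Fin (2 * P.Bt n)) :
    (List.ofFn y).getD (P.cCtl n s e t) false = y (coinIx P n (s, Sum.inr (e, t))) := by
  rw [OCoin.getD_ofFn, dif_pos (by rw [← coinIx_inr_val]; exact Fin.isLt _)]
  congr 1
  exact Fin.ext (coinIx_inr_val P n s e t).symm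

/-- **The block value of the coin string is the value of the active coins of the block.** [folklore] -/
theorem zOf_ofFn (y : QReg (P.K n)) (s : Fin (P.S n)) :
    P.zOf n (List.ofFn y) s =
      zAct P (P.bOf n s) fun a => y (coinIx P n (s, (actIdle P (P.bOf_le n s.isLt)).symm (Sum.inl a))) := by
  have hb := P.bOf_le n s.isLt
  unfold Shape.zOf zAct expo
  congr 1
  congr 1
  · symm
    rw [ofBits_eq_sum, ← Fin.sum_univ_eq_sum_range (fun j =>
      ((List.ofFn y).getD (P.cOff n s j) false).toNat * 2 ^ j) (P.bOf n s)]
    refine Fintype.sum_congr _ _ fun j => ?_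
    dsimp only
    rw [actIdle_symm_inl_inl]
    have hj' : (splitFin hb).symm (Sum.inl j) = (⟨j, by omega⟩ : Fin (P.bM n)) := Fin.ext (by simp)
    rw [hj', ← getD_ofFn_cOff P y s ⟨j, by omega⟩]
  · symm
    rw [Fintype.sum_prod_type, ← Fin.sum_univ_eq_sum_range (fun e => 2 ^ e *
      ∑ t ∈ range (2 * P.Bt n), ((List.ofFn y).getD (P.cCtl n s e t) false).toNat) (P.bOf n s)]
    refine Fintype.sum_congr _ _ fun e => ?_
    rw [Finset.mul_sum, ← Fin.sum_univ_eq_sum_range (fun t => 2 ^ (e : ℕ) *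
      ((List.ofFn y).getD (P.cCtl n s e t) false).toNat) (2 * P.Bt n)]
    refine Fintype.sum_congr _ _ fun t => ?_
    dsimp only
    rw [actIdle_symm_inl_inr, mul_comm]
    have he' : (splitFin hb).symm (Sum.inl e) = (⟨e, by omega⟩ : Fin (P.bM n)) := Fin.ext (by simp)
    rw [he', ← getD_ofFn_cCtl P y s ⟨e, by omega⟩ t]

end Fibre

/-! ### The fibre condition, block by block -/

section FibreCond

variable {n : ℕ} (A : Language Bool)

/-- Off the queried value slots the work content of `V` is clear. [folklore] -/
def ZeroOff (ρ : QReg (mW P n)) : Prop := ∀ l : Fin (mW P n), ¬ IsSlot P n (P.DD n + l) → ρ l = false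

/-- Being clear off the slots is decidable. [folklore] -/
instance ZeroOff.decidable : DecidablePred (ZeroOff P (n := n)) := fun ρ => by
  unfold ZeroOff; infer_instance

/-- Queried value slots are work wires. [folklore] -/
theorem vW_sub_lt (s : Fin (P.S n)) (i : Fin (P.bOf n s)) : vW P n s i - P.DD n < mW P n := by
  have h1 := vW_lt_hBase P n s.isLt (lt_of_lt_of_le i.isLt (P.bOf_le n s.isLt))
  have h2 := hBase_le_NW P n
  have h3 : NW P n = P.DD n + mW P n := by simp only [NW, Shape.DD]; omega
  have h4 := DD_le_Wblk P n
  have h5 := Wblk_le_vW P n s i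
  omega

/-- `DD ≤ vW`. [folklore] -/
theorem DD_le_vW (s i : ℕ) : P.DD n ≤ vW P n s i := le_trans (DD_le_Wblk P n) (Wblk_le_vW P n s i)

/-- The block coordinates of a queried value slot. [folklore] -/
theorem div_vW {s i : ℕ} (hi : i < P.bM n) : (vW P n s i - Wblk P n) / P.bM n = s := by
  have hbM : 0 < P.bM n := by omega
  unfold vW; rw [Nat.add_assoc, Nat.add_sub_cancel_left, Nat.add_comm, Nat.add_mul_div_right _ _ hbM,
    Nat.div_eq_of_lt hi, Nat.zero_add]

/-- The bit coordinate of a queried value slot. [folklore] -/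
theorem mod_vW {s i : ℕ} (hi : i < P.bM n) : (vW P n s i - Wblk P n) % P.bM n = i := by
  unfold vW; rw [Nat.add_assoc, Nat.add_sub_cancel_left, Nat.add_comm, Nat.add_mul_mod_self_right, Nat.mod_eq_of_lt hi]

/-- **The written bits of block `s`, read off a work content.** [folklore] -/
def ωOf (ρ : QReg (mW P n)) (s : Fin (P.S n)) : Fin (P.bOf n s) → Bool :=
  fun i => ρ ⟨vW P n s i - P.DD n, vW_sub_lt P s i⟩

/-- Reading a tuple of block bits at natural coordinates (zero out of range). [folklore] -/
def ωget (ω : (s : Fin (P.S n)) → Fin (P.bOf n s) → Bool) (s i : ℕ) : Bool :=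
  if hs : s < P.S n then (if hi : i < P.bOf n s then ω ⟨s, hs⟩ ⟨i, hi⟩ else false) else false

/-- **The work content holding given block bits** (clear elsewhere). [folklore] -/
def ρOf (ω : (s : Fin (P.S n)) → Fin (P.bOf n s) → Bool) : QReg (mW P n) := fun l =>
  if IsSlot P n (P.DD n + l) then
    ωget P ω ((P.DD n + l - Wblk P n) / P.bM n) ((P.DD n + l - Wblk P n) % P.bM n)
  else false

/-- `ρOf ω` is clear off the slots. [folklore] -/
theorem zeroOff_ρOf (ω : (s : Fin (P.S n)) → Fin (P.bOf n s) → Bool) : ZeroOff P (ρOf P ω) :=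
  fun l hl => by simp [ρOf, hl]

/-- Reading back the block bits. [folklore] -/
theorem ωOf_ρOf (ω : (s : Fin (P.S n)) → Fin (P.bOf n s) → Bool) : ωOf P (ρOf P ω) = ω := by
  funext s i
  have hb := P.bOf_le n s.isLt
  have hi : (i : ℕ) < P.bM n := lt_of_lt_of_le i.isLt hb
  have hsl := isSlot_vW P (n := n) s.isLt i.isLt
  have hDD : P.DD n + (vW P n s i - P.DD n) = vW P n s i := Nat.add_sub_cancel' (DD_le_vW P s i)
  unfold ωOf ρOf
  dsimp only
  rw [hDD, if_pos hsl, div_vW P hi, mod_vW P hi]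
  unfold ωget
  rw [dif_pos s.isLt, dif_pos i.isLt]

/-- Writing back a clear-off-slots content. [folklore] -/
theorem ρOf_ωOf {ρ : QReg (mW P n)} (hρ : ZeroOff P ρ) : ρOf P (ωOf P ρ) = ρ := by
  funext l
  unfold ρOf
  by_cases hsl : IsSlot P n (P.DD n + l)
  · rw [if_pos hsl]
    obtain ⟨hv, hs, -⟩ := vW_of_isSlot P hsl
    have hi' : (P.DD n + l - Wblk P n) % P.bM n < P.bOf n ((P.DD n + l - Wblk P n) / P.bM n) := hsl.2.2
    rw [ωget, dif_pos hs, dif_pos hi']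
    unfold ωOf
    congr 1
    exact Fin.ext (by simp only; omega)
  · rw [if_neg hsl, hρ l hsl]

/-- **Work contents clear off the slots correspond to tuples of block bits.** [folklore] -/
def fibEquiv : {ρ : QReg (mW P n) // ZeroOff P ρ} ≃ ((s : Fin (P.S n)) → Fin (P.bOf n s) → Bool) where
  toFun ρ := ωOf P ρ.1
  invFun ω := ⟨ρOf P ω, zeroOff_ρOf P ω⟩
  left_inv ρ := Subtype.ext (ρOf_ωOf P ρ.2)
  right_inv ω := ωOf_ρOf P ω

/-- The fibre map of a block on the block's coins of `y` writes the answer bits of the block. [folklore] -/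
theorem gS_blockSplit (y : QReg (P.K n)) (s : Fin (P.S n)) (i : Fin (P.bOf n s)) :
    gS P A s (blockSplit (coinSigma P n) y s) i = ans P y A s i := by
  simp only [gS, Gfun, blockSplit_apply, coinSigma_symm_apply, ← zOf_ofFn, ans]

/-- The work content of `V` is clear off the slots. [folklore] -/
theorem zeroOff_Rw (y : QReg (P.K n)) : ZeroOff P (Rw P y A) := fun l hl => by simp [Rw, vbit, hl]

/-- **The fibre condition splits over the blocks**: `V` writes `ρ` on the coins `y` iff `ρ` is
clear off the slots and every block's answer bits are the block's part of `ρ`. [folklore] -/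
theorem Rw_eq_iff (y : QReg (P.K n)) (ρ : QReg (mW P n)) :
    Rw P y A = ρ ↔ ZeroOff P ρ ∧ ∀ s : Fin (P.S n), gS P A s (blockSplit (coinSigma P n) y s) = ωOf P ρ s := by
  constructor
  · rintro rfl
    refine ⟨zeroOff_Rw P A y, fun s => funext fun i => ?_⟩
    have hb := P.bOf_le n s.isLt
    have hi : (i : ℕ) < P.bM n := lt_of_lt_of_le i.isLt hb
    have hDD : P.DD n + (vW P n s i - P.DD n) = vW P n s i := Nat.add_sub_cancel' (DD_le_vW P s i)
    rw [gS_blockSplit]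
    simp only [ωOf, Rw, vbit, hDD, if_pos (isSlot_vW P (n := n) s.isLt i.isLt), div_vW P hi, mod_vW P hi]
  · rintro ⟨hZ, hω⟩
    funext l
    simp only [Rw, vbit]
    by_cases hsl : IsSlot P n (P.DD n + l)
    · rw [if_pos hsl]
      obtain ⟨hv, hs, -⟩ := vW_of_isSlot P hsl
      have hi' : (P.DD n + l - Wblk P n) % P.bM n < P.bOf n ((P.DD n + l - Wblk P n) / P.bM n) := hsl.2.2
      have h := congrFun (hω ⟨_, hs⟩) ⟨_, hi'⟩
      rw [gS_blockSplit] at h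
      simp only [ωOf] at h
      rw [h]
      congr 1
      exact Fin.ext (by simp only; omega)
    · rw [if_neg hsl, hZ l hsl]

end FibreCond

/-! ### The fibre norm-sum of a read-out is a product over the blocks -/

section BlockProduct

variable {n : ℕ} (A : Language Bool)

/-- **The idle factor of block `s`** for read-out `γ`: `∏_{c idle} |φ_c(0) + φ_c(1)|²`. [folklore] -/
def Iidle (γ : QReg (P.K n)) (s : Fin (P.S n)) : ℝ :=
  ∏ i : Idle P n (P.bOf n s),
    ‖phi P γ (coinIx P n (s, (actIdle P (P.bOf_le n s.isLt)).symm (Sum.inr i))) false +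
      phi P γ (coinIx P n (s, (actIdle P (P.bOf_le n s.isLt)).symm (Sum.inr i))) true‖ ^ 2

/-- **The active fibre norm-sum of block `s`** for read-out `γ`. [folklore] -/
def Aact (γ : QReg (P.K n)) (s : Fin (P.S n)) : ℝ :=
  ∑ ω : Fin (P.bOf n s) → Bool, ‖∑ ya ∈ univ.filter (fun ya : Act P n (P.bOf n s) → Bool =>
      Gfun P A n s (zAct P (P.bOf n s) ya) = ω),
    ∏ a, phi P γ (coinIx P n (s, (actIdle P (P.bOf_le n s.isLt)).symm (Sum.inl a))) (ya a)‖ ^ 2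

/-- **The fibre norm-sum of `V` factorises over the blocks** (blockwise fibre condition
`Rw_eq_iff`, `fiber_norm_sq_blocks`, then `fiber_norm_sq_idle` in every block).
[cite: Kitaev1995, §3 Lemma 8] -/
theorem fiber_norm_sq_Rw (γ : QReg (P.K n)) :
    ∑ ρ : QReg (mW P n), ‖∑ y ∈ univ.filter (fun y : QReg (P.K n) => Rw P y A = ρ), ∏ c, phi P γ c (y c)‖ ^ 2 =
      ∏ s : Fin (P.S n), Iidle P γ s * Aact P A γ s := by
  set T : QReg (mW P n) → ℝ := fun ρ =>
    ‖∑ y ∈ univ.filter (fun y : QReg (P.K n) => Rw P y A = ρ), ∏ c, phi P γ c (y c)‖ ^ 2 with hT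
  -- only contents clear off the slots have nonempty fibres
  have h1 : ∑ ρ, T ρ = ∑ ρ ∈ univ.filter (ZeroOff P), T ρ := by
    refine (sum_filter_of_ne fun ρ _ hne => ?_).symm
    by_contra hZ
    apply hne
    have hempty : univ.filter (fun y : QReg (P.K n) => Rw P y A = ρ) = ∅ :=
      filter_eq_empty_iff.2 fun y _ h => hZ (h ▸ zeroOff_Rw P A y)
    simp [hT, hempty]
  -- reindex by the block bits
  have h2 : ∑ ρ ∈ univ.filter (ZeroOff P), T ρ =
      ∑ ω : ((s : Fin (P.S n)) → Fin (P.bOf n s) → Bool), T (ρOf P ω) := by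
    rw [sum_subtype (univ.filter (ZeroOff P)) (p := ZeroOff P) (fun ρ => by simp)]
    exact Fintype.sum_equiv (fibEquiv P) _ _ fun ρ => by
      change T ρ.1 = T (ρOf P (ωOf P ρ.1)); rw [ρOf_ωOf P ρ.2]
  -- the fibre of `ρOf ω` is the blockwise fibre of `ω`
  have h3 : ∀ ω : ((s : Fin (P.S n)) → Fin (P.bOf n s) → Bool), T (ρOf P ω) =
      ‖∑ y ∈ univ.filter (fun y : QReg (P.K n) =>
        ∀ s, gS P A s (fun j => y ((coinSigma P n).symm ⟨s, j⟩)) = ω s), ∏ c, phi P γ c (y c)‖ ^ 2 := by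
    intro ω
    simp only [hT]
    congr 2
    refine sum_congr (filter_congr fun y _ => ?_) fun _ _ => rfl
    rw [Rw_eq_iff, ωOf_ρOf]
    exact ⟨fun h => h.2, fun h => ⟨zeroOff_ρOf P ω, h⟩⟩
  have key := fiber_norm_sq_blocks (coinSigma P n) (phi P γ) (gS P A)
  rw [h1, h2, Finset.sum_congr rfl fun ω _ => h3 ω]
  convert key using 1
  · refine Fintype.sum_congr _ _ fun ω => ?_
    congr 2
    refine Finset.sum_congr ?_ fun _ _ => rfl
    ext y
    simp only [Finset.mem_filter, Finset.mem_univ, true_and]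
  · refine prod_congr rfl fun s _ => ?_
    simp only [coinSigma_symm_apply]
    exact (fiber_norm_sq_idle (actIdle P (P.bOf_le n s.isLt)) (fun j => phi P γ (coinIx P n (s, j)))
      (fun ya => Gfun P A n s (zAct P (P.bOf n s) ya))).symm

end BlockProduct

/-! ### Read-outs block by block -/

section ReadOut

variable {n : ℕ} (A : Language Bool)

/-- The sine-test pattern on a slot. [cite: Kitaev1995, §3 Remark 8] -/
def sigS : Slot P n → Bool
  | Sum.inl _ => false
  | Sum.inr (_, t) => decide (P.Bt n ≤ (t : ℕ))

/-- The pattern of a coin is the pattern of its slot. [folklore] -/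
theorem sig_coinIx (s : Fin (P.S n)) (u : Slot P n) : sig P n (coinIx P n (s, u)) = sigS P u := by
  rcases u with j | ⟨e, t⟩
  · rw [sig_inl]; rfl
  · rw [sig_inr]; rfl

/-- The one-coin factor read off the block's read-out `gs : Slot → Bool`. [folklore] -/
def phiS (gs : Slot P n → Bool) (u : Slot P n) (v : Bool) : ℂ :=
  if v then (if gs u then (-1 : ℂ) else 1) * (if sigS P u then -Complex.I else 1) else 1

/-- The one-coin factor of a coin of block `s` in terms of the block's read-out. [folklore] -/
theorem phi_coinIx (γ : QReg (P.K n)) (s : Fin (P.S n)) (u : Slot P n) (v : Bool) :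
    phi P γ (coinIx P n (s, u)) v = phiS P (blockSplit (coinSigma P n) γ s) u v := by
  unfold phi phiS
  rw [sig_coinIx]
  rfl

/-- The idle factor in terms of the block's read-out. [folklore] -/
def IidleS (s : Fin (P.S n)) (gs : Slot P n → Bool) : ℝ :=
  ∏ i : Idle P n (P.bOf n s),
    ‖phiS P gs ((actIdle P (P.bOf_le n s.isLt)).symm (Sum.inr i)) false +
      phiS P gs ((actIdle P (P.bOf_le n s.isLt)).symm (Sum.inr i)) true‖ ^ 2

/-- The active fibre norm-sum in terms of the block's read-out. [folklore] -/
def AactS (s : Fin (P.S n)) (gs : Slot P n → Bool) : ℝ :=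
  ∑ ω : Fin (P.bOf n s) → Bool, ‖∑ ya ∈ univ.filter (fun ya : Act P n (P.bOf n s) → Bool =>
      Gfun P A n s (zAct P (P.bOf n s) ya) = ω),
    ∏ a, phiS P gs ((actIdle P (P.bOf_le n s.isLt)).symm (Sum.inl a)) (ya a)‖ ^ 2

/-- `Iidle` through the block read-out. [folklore] -/
theorem Iidle_eq (γ : QReg (P.K n)) (s : Fin (P.S n)) : Iidle P γ s = IidleS P s (blockSplit (coinSigma P n) γ s) := by
  simp only [Iidle, IidleS, phi_coinIx]

/-- `Aact` through the block read-out. [folklore] -/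
theorem Aact_eq (γ : QReg (P.K n)) (s : Fin (P.S n)) : Aact P A γ s = AactS P A s (blockSplit (coinSigma P n) γ s) := by
  simp only [Aact, AactS, phi_coinIx]

/-- `|1 + p|² + |1 - p|² = 4` for a unimodular `p`. [folklore] -/
theorem norm_sq_one_add_add {p : ℂ} (hp : ‖p‖ = 1) : ‖1 + p‖ ^ 2 + ‖1 + -1 * p‖ ^ 2 = 4 := by
  have h : ‖p‖ ^ 2 = 1 := by rw [hp, one_pow]
  rw [Complex.sq_norm, Complex.normSq_apply] at h
  rw [Complex.sq_norm, Complex.sq_norm, Complex.normSq_apply, Complex.normSq_apply]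
  simp only [Complex.add_re, Complex.one_re, Complex.mul_re, Complex.neg_re, Complex.neg_im, Complex.one_im,
    Complex.add_im, Complex.mul_im]
  nlinarith [h]

/-- The phase factors are unimodular. [folklore] -/
theorem norm_ite_negI (c : Bool) : ‖(if c then -Complex.I else (1 : ℂ))‖ = 1 := by
  cases c <;> simp

/-- **Summing out the idle read-out**: `∑_{g} ∏_i |1 + (-1)^{g_i} p_i|² = 4^{#I}`. [folklore] -/
theorem sum_prod_idle {I : Type*} [Fintype I] [DecidableEq I] (p : I → ℂ) (hp : ∀ i, ‖p i‖ = 1) :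
    ∑ g : I → Bool, ∏ i, ‖(1 : ℂ) + (if g i then (-1 : ℂ) else 1) * p i‖ ^ 2 = 4 ^ Fintype.card I := by
  rw [sum_pi_bool_prod_real fun i c => ‖(1 : ℂ) + (if c then (-1 : ℂ) else 1) * p i‖ ^ 2]
  simp only [Bool.false_eq_true, if_false, one_mul, if_true]
  rw [Finset.prod_congr rfl fun i _ => norm_sq_one_add_add (hp i), prod_const, card_univ]

/-- The idle read-out of block `s` sums out to `4^{#Idle}`. [folklore] -/
theorem sum_IidleS (s : Fin (P.S n)) (ga : Act P n (P.bOf n s) → Bool) :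
    ∑ gi : Idle P n (P.bOf n s) → Bool,
        IidleS P s ((Equiv.arrowCongr (actIdle P (P.bOf_le n s.isLt)) (Equiv.refl Bool)).symm
          ((Equiv.sumArrowEquivProdArrow _ _ Bool).symm (ga, gi))) =
      4 ^ Fintype.card (Idle P n (P.bOf n s)) := by
  rw [← sum_prod_idle (fun i : Idle P n (P.bOf n s) =>
    if sigS P ((actIdle P (P.bOf_le n s.isLt)).symm (Sum.inr i)) then -Complex.I else 1) (fun i => norm_ite_negI _)]
  refine Fintype.sum_congr _ _ fun gi => prod_congr rfl fun i _ => ?_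
  simp [phiS, Equiv.arrowCongr, Equiv.sumArrowEquivProdArrow]

/-- The offset factor. [folklore] -/
theorem phiS_offset (gs : Slot P n → Bool) (s : Fin (P.S n)) (t : Fin (P.bOf n s)) (v : Bool) :
    phiS P gs ((actIdle P (P.bOf_le n s.isLt)).symm (Sum.inl (Sum.inl t))) v =
      if v && gs ((actIdle P (P.bOf_le n s.isLt)).symm (Sum.inl (Sum.inl t))) then (-1 : ℂ) else 1 := by
  rw [actIdle_symm_inl_inl]
  cases v <;> simp [phiS, sigS]

/-- The control factor is Kitaev's read-out factor. [folklore] -/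
theorem phiS_control (gs : Slot P n → Bool) (s : Fin (P.S n)) (j : Fin (P.bOf n s) × Fin (2 * P.Bt n)) (v : Bool) :
    phiS P gs ((actIdle P (P.bOf_le n s.isLt)).symm (Sum.inl (Sum.inr j))) v =
      signChar (fun j : Fin (P.bOf n s) × Fin (2 * P.Bt n) => gs ((actIdle P (P.bOf_le n s.isLt)).symm (Sum.inl (Sum.inr j))))
        (fun j => decide (P.Bt n ≤ (j.2 : ℕ))) j v := by
  cases v <;> simp [phiS, sigS, signChar, actIdle_symm_inl_inr]

/-- **The weight of the Fourier label `u` for block `s`**: `S_G(u)/4^b`. [cite: Shor1997, §5] -/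
def Wt (n s : ℕ) (u : ℕ) : ℝ := fiberSum (2 ^ P.bOf n s) (Gfun P A n s) u / 4 ^ P.bOf n s

/-- **Summing out the offset read-out of the active part**: the mixture over `u` of the products
of the single-test probabilities of the block's active controls (`sum_fiber_norm_sq_active_signChar`).
[cite: Kitaev1995, §3 (Remark 8, Lemma 8) and §4] [cite: Shor1997, §5] -/
theorem sum_AactS (s : Fin (P.S n)) (gC : Fin (P.bOf n s) × Fin (2 * P.Bt n) → Bool)
    (gi : Idle P n (P.bOf n s) → Bool) :
    ∑ gT : Fin (P.bOf n s) → Bool,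
        AactS P A s ((Equiv.arrowCongr (actIdle P (P.bOf_le n s.isLt)) (Equiv.refl Bool)).symm
          ((Equiv.sumArrowEquivProdArrow _ _ Bool).symm ((Equiv.sumArrowEquivProdArrow _ _ Bool).symm (gT, gC), gi))) =
      4 ^ P.bOf n s * 4 ^ Fintype.card (Fin (P.bOf n s) × Fin (2 * P.Bt n)) *
        ∑ u ∈ range (2 ^ P.bOf n s), Wt P A n s u *
          ∏ j : Fin (P.bOf n s) × Fin (2 * P.Bt n), testWeight (gC j) (decide (P.Bt n ≤ (j.2 : ℕ)))
            (2 * Real.pi * u * 2 ^ (j.1 : ℕ) / 2 ^ P.bOf n s) := by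
  have key := sum_fiber_norm_sq_active_signChar (b := P.bOf n s) (fun j : Fin (P.bOf n s) × Fin (2 * P.Bt n) => (j.1 : ℕ))
    gC (fun j => decide (P.Bt n ≤ (j.2 : ℕ))) (Gfun P A n s)
  rw [mul_sum]
  refine Eq.trans ?_ (key.trans (sum_congr rfl fun u _ => ?_))
  · refine Fintype.sum_congr _ _ fun gT => ?_
    unfold AactS
    refine Fintype.sum_congr _ _ fun ω => ?_
    congr 2
    refine sum_congr ?_ fun ya _ => ?_
    · ext ya; simp only [mem_filter, mem_univ, true_and, zAct]
    · rw [Fintype.prod_sum_type]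
      congr 1
      · refine prod_congr rfl fun t _ => ?_
        rw [phiS_offset]
        simp [Equiv.arrowCongr, Equiv.sumArrowEquivProdArrow, actIdle_symm_inl_inl]
      · refine prod_congr rfl fun j _ => ?_
        rw [phiS_control]
        congr 1
        funext j'
        simp [Equiv.arrowCongr, Equiv.sumArrowEquivProdArrow, actIdle_symm_inl_inr]
  · unfold Wt
    field_simp

end ReadOut

/-! ### The law of the hit pattern -/

section Law

variable {n : ℕ} (A : Language Bool)

/-- The block read-out split into (offsets, controls) and idle parts. [folklore] -/
def rdSplit (s : Fin (P.S n)) : (Slot P n → Bool) ≃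
    ((Fin (P.bOf n s) → Bool) × (Fin (P.bOf n s) × Fin (2 * P.Bt n) → Bool)) × (Idle P n (P.bOf n s) → Bool) :=
  ((Equiv.arrowCongr (actIdle P (P.bOf_le n s.isLt)) (Equiv.refl Bool)).trans
    (Equiv.sumArrowEquivProdArrow _ _ Bool)).trans
    (Equiv.prodCongr (Equiv.sumArrowEquivProdArrow _ _ Bool) (Equiv.refl _))

/-- `rdSplit` inverted is the composite of the inverses (definitional bookkeeping). [folklore] -/
theorem rdSplit_symm_apply (s : Fin (P.S n)) (gT : Fin (P.bOf n s) → Bool)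
    (gC : Fin (P.bOf n s) × Fin (2 * P.Bt n) → Bool) (gi : Idle P n (P.bOf n s) → Bool) :
    (rdSplit P s).symm ((gT, gC), gi) =
      (Equiv.arrowCongr (actIdle P (P.bOf_le n s.isLt)) (Equiv.refl Bool)).symm
        ((Equiv.sumArrowEquivProdArrow _ _ Bool).symm ((Equiv.sumArrowEquivProdArrow _ _ Bool).symm (gT, gC), gi)) := rfl

/-- **The active controls of block `s` read off a coin read-out.** [folklore] -/
def ctrlRead (γ : QReg (P.K n)) (s : Fin (P.S n)) : Fin (P.bOf n s) × Fin (2 * P.Bt n) → Bool :=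
  fun j => γ (coinIx P n (s, (actIdle P (P.bOf_le n s.isLt)).symm (Sum.inl (Sum.inr j))))

/-- The active controls read off the block read-out. [folklore] -/
def ctrlS (s : Fin (P.S n)) (gs : Slot P n → Bool) : Fin (P.bOf n s) × Fin (2 * P.Bt n) → Bool :=
  fun j => gs ((actIdle P (P.bOf_le n s.isLt)).symm (Sum.inl (Sum.inr j)))

/-- `ctrlRead` through the block read-out. [folklore] -/
theorem ctrlRead_eq (γ : QReg (P.K n)) (s : Fin (P.S n)) :
    ctrlRead P γ s = ctrlS P s (blockSplit (coinSigma P n) γ s) := rfl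

/-- The controls part of a split read-out. [folklore] -/
theorem ctrlS_rdSplit_symm (s : Fin (P.S n)) (gT : Fin (P.bOf n s) → Bool)
    (gC : Fin (P.bOf n s) × Fin (2 * P.Bt n) → Bool) (gi : Idle P n (P.bOf n s) → Bool) :
    ctrlS P s ((rdSplit P s).symm ((gT, gC), gi)) = gC := by
  funext j
  simp [ctrlS, rdSplit, Equiv.arrowCongr, Equiv.sumArrowEquivProdArrow, actIdle_symm_inl_inr]

/-- The idle factor of a split read-out only reads the idle part. [folklore] -/
theorem IidleS_rdSplit_symm (s : Fin (P.S n)) (gT : Fin (P.bOf n s) → Bool)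
    (gC : Fin (P.bOf n s) × Fin (2 * P.Bt n) → Bool) (gi : Idle P n (P.bOf n s) → Bool) :
    IidleS P s ((rdSplit P s).symm ((gT, gC), gi)) =
      ∏ i : Idle P n (P.bOf n s), ‖(1 : ℂ) + (if gi i then (-1 : ℂ) else 1) *
        (if sigS P ((actIdle P (P.bOf_le n s.isLt)).symm (Sum.inr i)) then -Complex.I else 1)‖ ^ 2 := by
  refine prod_congr rfl fun i _ => ?_
  simp [phiS, rdSplit, Equiv.arrowCongr, Equiv.sumArrowEquivProdArrow]

/-- **The probability that block `s` hits**, for a hit predicate `h s` on its active controls: the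
mixture over the Fourier label `u` of the product law of the single tests. [cite: Kitaev1995, §3 (Remark 8, Lemma 8)] [cite: Shor1997, §5] -/
def pT (h : (s : Fin (P.S n)) → (Fin (P.bOf n s) × Fin (2 * P.Bt n) → Bool) → Bool) (s : Fin (P.S n)) : ℝ :=
  ∑ u ∈ range (2 ^ P.bOf n s), Wt P A n s u *
    ∑ gC ∈ univ.filter (fun gC : Fin (P.bOf n s) × Fin (2 * P.Bt n) → Bool => h s gC = true),
      ∏ j : Fin (P.bOf n s) × Fin (2 * P.Bt n), testWeight (gC j) (decide (P.Bt n ≤ (j.2 : ℕ)))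
        (2 * Real.pi * u * 2 ^ (j.1 : ℕ) / 2 ^ P.bOf n s)

/-- The label weights of a block form a probability distribution. [folklore] -/
theorem sum_Wt (s : ℕ) : ∑ u ∈ range (2 ^ P.bOf n s), Wt P A n s u = 1 := by
  unfold Wt
  rw [← sum_div, sum_fiberSum (Nat.two_pow_pos _)]
  have h4 : (4 : ℝ) ^ P.bOf n s = ((2 ^ P.bOf n s : ℕ) : ℝ) ^ 2 := by
    push_cast; rw [← pow_mul, mul_comm, pow_mul]; norm_num
  rw [h4, div_self (by positivity)]

/-- The single tests of the active controls form a probability distribution. [folklore] -/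
theorem sum_prod_testWeight (s : Fin (P.S n)) (u : ℕ) :
    ∑ gC : Fin (P.bOf n s) × Fin (2 * P.Bt n) → Bool,
        ∏ j : Fin (P.bOf n s) × Fin (2 * P.Bt n), testWeight (gC j) (decide (P.Bt n ≤ (j.2 : ℕ)))
          (2 * Real.pi * u * 2 ^ (j.1 : ℕ) / 2 ^ P.bOf n s) = 1 := by
  rw [sum_pi_bool_prod_real fun (j : Fin (P.bOf n s) × Fin (2 * P.Bt n)) c =>
    testWeight c (decide (P.Bt n ≤ (j.2 : ℕ))) (2 * Real.pi * u * 2 ^ (j.1 : ℕ) / 2 ^ P.bOf n s)]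
  exact prod_eq_one fun j _ => testWeight_false_add_true _ _

/-- The two values of the block factor: `pT` on a hit, `1 - pT` otherwise. [folklore] -/
theorem sum_filter_eq_ite (h : (s : Fin (P.S n)) → (Fin (P.bOf n s) × Fin (2 * P.Bt n) → Bool) → Bool)
    (s : Fin (P.S n)) (β : Bool) :
    ∑ gC ∈ univ.filter (fun gC : Fin (P.bOf n s) × Fin (2 * P.Bt n) → Bool => h s gC = β),
        ∑ u ∈ range (2 ^ P.bOf n s), Wt P A n s u *
          ∏ j : Fin (P.bOf n s) × Fin (2 * P.Bt n), testWeight (gC j) (decide (P.Bt n ≤ (j.2 : ℕ)))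
            (2 * Real.pi * u * 2 ^ (j.1 : ℕ) / 2 ^ P.bOf n s) =
      if β then pT P A h s else 1 - pT P A h s := by
  have hswap : ∀ q : (Fin (P.bOf n s) × Fin (2 * P.Bt n) → Bool) → Prop, ∀ _ : DecidablePred q,
      ∑ gC ∈ univ.filter q, ∑ u ∈ range (2 ^ P.bOf n s), Wt P A n s u *
          ∏ j : Fin (P.bOf n s) × Fin (2 * P.Bt n), testWeight (gC j) (decide (P.Bt n ≤ (j.2 : ℕ)))
            (2 * Real.pi * u * 2 ^ (j.1 : ℕ) / 2 ^ P.bOf n s) =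
        ∑ u ∈ range (2 ^ P.bOf n s), Wt P A n s u * ∑ gC ∈ univ.filter q,
          ∏ j : Fin (P.bOf n s) × Fin (2 * P.Bt n), testWeight (gC j) (decide (P.Bt n ≤ (j.2 : ℕ)))
            (2 * Real.pi * u * 2 ^ (j.1 : ℕ) / 2 ^ P.bOf n s) := by
    intro q _
    rw [sum_comm]
    exact sum_congr rfl fun u _ => (mul_sum _ _ _).symm
  cases β
  · rw [if_neg Bool.false_ne_true, hswap]
    have htot := hswap (fun _ => True) inferInstance
    rw [Finset.filter_true_of_mem (fun _ _ => trivial)] at htot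
    have hsplit := sum_filter_add_sum_filter_not univ (fun gC : Fin (P.bOf n s) × Fin (2 * P.Bt n) → Bool => h s gC = true)
      (fun gC => ∑ u ∈ range (2 ^ P.bOf n s), Wt P A n s u *
          ∏ j : Fin (P.bOf n s) × Fin (2 * P.Bt n), testWeight (gC j) (decide (P.Bt n ≤ (j.2 : ℕ)))
            (2 * Real.pi * u * 2 ^ (j.1 : ℕ) / 2 ^ P.bOf n s))
    rw [htot, hswap, hswap] at hsplit
    have h1 : ∑ u ∈ range (2 ^ P.bOf n s), Wt P A n s u * ∑ gC : Fin (P.bOf n s) × Fin (2 * P.Bt n) → Bool,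
        ∏ j : Fin (P.bOf n s) × Fin (2 * P.Bt n), testWeight (gC j) (decide (P.Bt n ≤ (j.2 : ℕ)))
          (2 * Real.pi * u * 2 ^ (j.1 : ℕ) / 2 ^ P.bOf n s) = 1 := by
      rw [sum_congr rfl fun u _ => by rw [sum_prod_testWeight, mul_one], sum_Wt]
    rw [h1] at hsplit
    have h2 : (univ.filter fun gC : Fin (P.bOf n s) × Fin (2 * P.Bt n) → Bool => ¬ h s gC = true) =
        univ.filter fun gC => h s gC = false := filter_congr fun gC _ => by simp
    rw [h2] at hsplit
    unfold pT
    linarith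
  · rw [if_pos rfl, hswap]; rfl

end Law

/-! ### Assembly: the probability of a hit pattern -/

section Assembly

variable {n : ℕ} (A : Language Bool)

/-- The wire counts of a block: idle coins, active offsets and active controls make up the slot. [folklore] -/
theorem card_idle_add (s : Fin (P.S n)) :
    Fintype.card (Idle P n (P.bOf n s)) + P.bOf n s + Fintype.card (Fin (P.bOf n s) × Fin (2 * P.Bt n)) = P.wS n := by
  have hb := P.bOf_le n s.isLt
  simp only [Fintype.card_sum, Fintype.card_prod, Fintype.card_fin]
  have hd : P.bM n - P.bOf n s + P.bOf n s = P.bM n := Nat.sub_add_cancel hb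
  unfold Shape.wS
  set d := P.bM n - P.bOf n s
  calc d + d * (2 * P.Bt n) + P.bOf n s + P.bOf n s * (2 * P.Bt n)
      = (d + P.bOf n s) + (d + P.bOf n s) * (2 * P.Bt n) := by ring
    _ = P.bM n + P.bM n * (2 * P.Bt n) := by rw [hd]

/-- **The factor of block `s` for a prescribed hit value**: summing the fibre norm-sums over the
read-outs of the block whose active controls give hit value `β`, the idle read-outs and the offset
read-outs sum out (`sum_prod_idle`, `sum_AactS`) and leave `4^{wS}` times `pT` or `1 - pT`.
[cite: Kitaev1995, §3 (Remark 8, Lemma 8)] -/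
theorem block_factor (h : (s : Fin (P.S n)) → (Fin (P.bOf n s) × Fin (2 * P.Bt n) → Bool) → Bool)
    (s : Fin (P.S n)) (β : Bool) :
    ∑ gs ∈ univ.filter (fun gs : Slot P n → Bool => h s (ctrlS P s gs) = β), IidleS P s gs * AactS P A s gs =
      4 ^ P.wS n * (if β then pT P A h s else 1 - pT P A h s) := by
  rw [← sum_filter_eq_ite, sum_filter, sum_filter, ← (rdSplit P s).symm.sum_comp, Fintype.sum_prod_type,
    Fintype.sum_prod_type, mul_sum]
  -- reorder: controls outside
  rw [sum_comm]
  refine Fintype.sum_congr _ _ fun gC => ?_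
  simp only [ctrlS_rdSplit_symm]
  split_ifs with hq
  · -- the offset and idle read-outs sum out
    have hidle : ∀ gT : Fin (P.bOf n s) → Bool, ∀ gi : Idle P n (P.bOf n s) → Bool,
        IidleS P s ((rdSplit P s).symm ((gT, gC), gi)) =
          ∏ i : Idle P n (P.bOf n s), ‖(1 : ℂ) + (if gi i then (-1 : ℂ) else 1) *
            (if sigS P ((actIdle P (P.bOf_le n s.isLt)).symm (Sum.inr i)) then -Complex.I else 1)‖ ^ 2 :=
      fun gT gi => IidleS_rdSplit_symm P s gT gC gi
    simp_rw [hidle]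
    rw [sum_comm]
    simp_rw [← mul_sum]
    have hact : ∀ gi : Idle P n (P.bOf n s) → Bool,
        ∑ gT : Fin (P.bOf n s) → Bool, AactS P A s ((rdSplit P s).symm ((gT, gC), gi)) =
          4 ^ P.bOf n s * 4 ^ Fintype.card (Fin (P.bOf n s) × Fin (2 * P.Bt n)) *
            ∑ u ∈ range (2 ^ P.bOf n s), Wt P A n s u *
              ∏ j : Fin (P.bOf n s) × Fin (2 * P.Bt n), testWeight (gC j) (decide (P.Bt n ≤ (j.2 : ℕ)))
                (2 * Real.pi * u * 2 ^ (j.1 : ℕ) / 2 ^ P.bOf n s) := fun gi => by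
      simp only [rdSplit_symm_apply]; exact sum_AactS P A s gC gi
    simp_rw [hact]
    rw [← sum_mul, sum_prod_idle _ (fun i => norm_ite_negI _), ← card_idle_add P s]
    ring
  · simp

/-- **The Born weight of a label `x γ ρ`** of the period-finding circuit: `4^{-K}` times the
squared fibre amplitude sum. [cite: Kitaev1995, §3 (Remark 8, Lemma 8)] -/
theorem norm_sq_runOn_tri (x : QReg n) (γ : QReg (P.K n)) (ρ : QReg (mW P n)) :
    ‖(circ P n).runOn A (basisState (padInput x (P.K n + mW P n))) (tri x γ ρ)‖ ^ 2 =
      (1 / 4) ^ P.K n * ‖∑ y ∈ univ.filter (fun y : QReg (P.K n) => Rw P y A = ρ), ∏ c, phi P γ c (y c)‖ ^ 2 := by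
  rw [circ, kitaevCircuit_runOn_tri_rel A (V P n) (sig P n) x (fun y => Rw P y A)
    (fun y => V_mulVec_coinInput P x y A) γ ρ, invSqrt2_pow_mul_pow, norm_mul, mul_pow, norm_pow,
    sum_congr rfl fun y _ => sPhase_mul_ySign_eq P y γ]
  congr 1
  rw [← pow_mul, norm_div, norm_one, Complex.norm_ofNat, mul_comm, pow_mul]
  norm_num

/-- **The read-out law of the hit pattern.** For hit predicates `h s` on the active controls of the
blocks and an event `acc` on the pattern of hits, the Born probability that the coin read-out `γ`
produces an accepted pattern is the probability of `acc` under INDEPENDENT hits, block `s`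
hitting with probability `pT s` (product over the blocks of `pT` / `1 - pT`).
[cite: Kitaev1995, §3 (Remark 8, Lemma 8) and §4] [cite: NielsenChuang2010, §2.2.8] -/
theorem prob_hitPattern (x : QReg n)
    (h : (s : Fin (P.S n)) → (Fin (P.bOf n s) × Fin (2 * P.Bt n) → Bool) → Bool)
    (acc : (Fin (P.S n) → Bool) → Bool) :
    ∑ γ ∈ univ.filter (fun γ : QReg (P.K n) => acc (fun s => h s (ctrlRead P γ s)) = true),
        ∑ ρ : QReg (mW P n), ‖(circ P n).runOn A (basisState (padInput x (P.K n + mW P n))) (tri x γ ρ)‖ ^ 2 =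
      ∑ β ∈ univ.filter (fun β : Fin (P.S n) → Bool => acc β = true),
        ∏ s, (if β s then pT P A h s else 1 - pT P A h s) := by
  -- the fibre norm-sums, block by block, as functions of the block read-outs
  have h1 : ∀ γ : QReg (P.K n), (∑ ρ : QReg (mW P n),
      ‖(circ P n).runOn A (basisState (padInput x (P.K n + mW P n))) (tri x γ ρ)‖ ^ 2) =
      (1 / 4 : ℝ) ^ P.K n * ∏ s, IidleS P s (blockSplit (coinSigma P n) γ s) *
        AactS P A s (blockSplit (coinSigma P n) γ s) := by
    intro γ
    simp_rw [norm_sq_runOn_tri]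
    rw [← mul_sum, fiber_norm_sq_Rw]
    simp only [Iidle_eq, Aact_eq]
  rw [sum_congr rfl fun γ _ => h1 γ, sum_filter, sum_filter]
  -- transport to block read-outs `Γ`
  rw [← (blockSplit (coinSigma P n)).symm.sum_comp]
  simp only [ctrlRead_eq, Equiv.apply_symm_apply]
  -- regroup by the hit pattern
  set pat : (Fin (P.S n) → Slot P n → Bool) → (Fin (P.S n) → Bool) := fun Γ s => h s (ctrlS P s (Γ s)) with hpat
  rw [← sum_fiberwise univ pat]
  refine Fintype.sum_congr _ _ fun β => ?_
  have hfib : ∀ Γ ∈ univ.filter (fun Γ => pat Γ = β),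
      (if acc (fun s => h s (ctrlS P s (Γ s))) = true then
        (1 / 4 : ℝ) ^ P.K n * ∏ s, IidleS P s (Γ s) * AactS P A s (Γ s) else 0) =
      if acc β = true then (1 / 4 : ℝ) ^ P.K n * ∏ s, IidleS P s (Γ s) * AactS P A s (Γ s) else 0 := by
    intro Γ hΓ
    have : (fun s => h s (ctrlS P s (Γ s))) = β := (mem_filter.1 hΓ).2
    rw [this]
  rw [sum_congr rfl hfib]
  split_ifs with hacc
  · -- the fibre of `β` is a product set
    have hset : univ.filter (fun Γ => pat Γ = β) =
        Fintype.piFinset fun s => univ.filter (fun gs : Slot P n → Bool => h s (ctrlS P s gs) = β s) := by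
      ext Γ
      simp only [mem_filter, mem_univ, true_and, Fintype.mem_piFinset, hpat, funext_iff]
    rw [hset, ← mul_sum, ← prod_univ_sum (fun s => univ.filter (fun gs : Slot P n → Bool => h s (ctrlS P s gs) = β s))
      (fun s gs => IidleS P s gs * AactS P A s gs), prod_congr rfl fun s _ => block_factor P A h s (β s),
      prod_mul_distrib, prod_const, card_univ, Fintype.card_fin, ← mul_assoc]
    have hK : (1 / 4 : ℝ) ^ P.K n * (4 ^ P.wS n) ^ P.S n = 1 := by
      rw [← pow_mul, Shape.K, mul_comm (P.S n), one_div, inv_pow, inv_mul_cancel₀ (by positivity)]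
    rw [hK, one_mul]
  · simp

/-- **The same over the measured strings**: the probability that the measured output `z` of the
period-finding circuit has an accepted hit pattern (hits read off the control wires).
[cite: Kitaev1995, §3 (Remark 8, Lemma 8) and §4] -/
theorem prob_hitPattern_out (x : QReg n)
    (h : (s : Fin (P.S n)) → (Fin (P.bOf n s) × Fin (2 * P.Bt n) → Bool) → Bool)
    (acc : (Fin (P.S n) → Bool) → Bool) :
    ∑ z ∈ univ.filter (fun z : QReg (n + (P.K n + mW P n)) =>
        acc (fun s => h s (ctrlRead P (fun j => z (coinWire n (P.K n) (mW P n) j)) s)) = true),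
        ‖(circ P n).runOn A (basisState (padInput x (P.K n + mW P n))) z‖ ^ 2 =
      ∑ β ∈ univ.filter (fun β : Fin (P.S n) → Bool => acc β = true),
        ∏ s, (if β s then pT P A h s else 1 - pT P A h s) := by
  have key := kitaevCircuit_prob_coins_rel A (V P n) (sig P n) x (fun y => Rw P y A)
    (fun y => V_mulVec_coinInput P x y A) (univ.filter fun γ : QReg (P.K n) => acc (fun s => h s (ctrlRead P γ s)) = true)
  rw [← prob_hitPattern P A x h acc]
  unfold circ
  refine Eq.trans (sum_congr (filter_congr fun z _ => ?_) fun _ _ => rfl) key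
  simp only [mem_filter, mem_univ, true_and]

end Assembly

end Lem75Q

end Literature.Barriers.QuantumAdvantage

end
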